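import Summits.Ventures.HSemireg.WedgeWeilPuritySchurStrip
import Summits.Ventures.HSemireg.WedgeWeilPurityLocus

/-!
# Venture HSemireg — W-PURITY in Schur form (2/2): ends_ker_eq and weilPurity_schur

HONEST FRAMING. Part of the Lean index of the computation cell `pub-hsemireg` (second enclosure wave, cut by seat p6 in the
conventions of seat p3's ENCLOSURE-PLAN-p3.md / build.py from th-7's kernel assets).  Finite-dimensional exterior algebra over a field ONLY:
no variety, no cohomology theory, no semiregularity map is constructed here; nothing here says that HC / HC_CM / HC_AV holds;
no Literature fact is declared or used.  The geometric DICTIONARY (why these ranks are the `HT`-side box ranks of the cell's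
STRUCTURE.md §1 / theory/FORMULA-N.md) lives in theory/FORMULA-N-th7.md PART B §A.3 / §N and is NOT asserted in Lean.

th-7's PART S2 — THE SCHUR FORM OF THE ENDS BLOCK (theory/th7/WPurityStructure.lean, PART S2 (text byte-identical in v2 a1636d8e15c55ff0 / v3 ae498f7d4ae161bb; th-7 g7, 2026-08-23; ×2 farm + NC-S2 at p6 g7), the block after PART S's `end Purity`), VERBATIM up to the
namespace (`HSemiregWeil` ↦ `Summit.Ventures.HSemireg.Wedge.Weil`), file 2 of 2.  At Weil type `(n,n)`, degree `n ≥ 1`: strip maps `σ_D` (left inverse of `· ∧ E_D`),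
`ψ₊ := σ_{Gm}∘(∧f) : E₊ → E₋` and `ψ₋ := σ_{Dm}∘(∧f) : E₋ → E₊` with `θ₊∧f = ψ₊θ₊ ∧ w₊`, `θ₋∧f = ψ₋θ₋ ∧ w₋`, each of rank `ρ = rank H_n(q)` on the ends
(`finrank_map_psiP` / `finrank_map_psiM`); ends expansion with the two summands independent; **`ends_ker_eq`** (`a ≠ 0`): `Ends ⊓ ker(∧v) = J(E₊ ⊓ ker(ψ₋ψ₊ − ab·id))`,
`J = id − a⁻¹ψ₊` injective on `E₊`; and **`weilPurity_schur (hn : 1 ≤ n) (q) (ha : a ≠ 0) (b)`**: `finrank range(∧v ∣ ⋀ⁿ) + 2ρ + dim(E₊ ⊓ ker(ψ₋ψ₊ − ab))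
= C(2n,n)·ρ + 2·C(2n,n)`, i.e. rank = `C(2n,n)(2+ρ) − 2ρ − dim ker(ψ₋ψ₊ − ab ∣ E₊)` for EVERY `q`, `b`, field — the SHAPE of W-PURITY(ρ) in the kernel; the
only remaining non-kernel content is the identification of `ψ₋ψ₊ ∣ E₊` with `S(q) = (−1)ⁿ(H_n(q)Ω_n)²` (derived ×2, numerics ×2 codes n ≤ 6).  This file: section SchurNN (Weil type `(n,n)`): `psiP`/`psiM`, `finrank_map_psiP/psiM`, the ends expansion, `schurOp`, **`ends_ker_eq`**, `finrank_ends_ker`, **`weilPurity_schur`**.  RE-CUT (p6 g8, 04:35Z 2026-08-23, t-7 g8's dedup.landed diagnosis): th-7's two block-cardinality lemmas `card_Dm_nn` / `card_Gm_nn` of this section are NOT re-declared here — the identical statements landed with `WedgeWeilPurityLocus.lean` (namespace `….Wedge.WeilPurity`) and are imported and opened instead; th-7's use sites stay verbatim.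
-/

open Module Set Set.powersetCard Summit.Ventures.HSemireg.Wedge.Hankel
-- the two block-cardinality lemmas live in WedgeWeilPurityLocus.lean (gate dedup): reuse them
open Summit.Ventures.HSemireg.Wedge.WeilPurity (card_Dm_nn card_Gm_nn)

namespace Summit.Ventures.HSemireg.Wedge.Weil

variable (K : Type*) [Field K]

section SchurNN

variable (n : ℕ)

/-- `ψ₊ := σ_{Gm} ∘ (· ∧ f)` and `ψ₋ := σ_{Dm} ∘ (· ∧ f)` at Weil type `(n,n)`. -/
noncomputable def psiP (q : ℕ → K) : HT K (In (n + n)) →ₗ[K] HT K (In (n + n)) :=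
  strip K (Gm (n + n) n) ∘ₗ LinearMap.mulRight K (w K (n + n) (n + n) q)

/-- `ψ₋ := σ_{Dm} ∘ (· ∧ f)` at Weil type `(n,n)`. -/
noncomputable def psiM (q : ℕ → K) : HT K (In (n + n)) →ₗ[K] HT K (In (n + n)) :=
  strip K (Dm (n + n) n) ∘ₗ LinearMap.mulRight K (w K (n + n) (n + n) q)

variable {n}

/-- `(Gm)ᶜ = Dm` at type `(n,n)`. -/
lemma compl_Gm : (Gm (n + n) n)ᶜ = Dm (n + n) n := by
  rw [Gm, compl_compl]

/-- `E₊ ∧ f ⊆ Sp{Gm ⊆ r, |r| = n + |Gm|}`. -/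
lemma EP_mul_f_mem (q : ℕ → K) {θ : HT K (In (n + n))} (hθ : θ ∈ Hom K (In (n + n)) (Gm (n + n) n) n) :
    θ * w K (n + n) (n + n) q ∈
      Sp K (fun r : Finset (In (n + n)) => Gm (n + n) n ⊆ r ∧ r.card = n + (Gm (n + n) n).card) := by
  rw [Hom_eq_Sp] at hθ
  refine mul_mem_Sp (P := fun s => s ⊆ Gm (n + n) n ∧ s.card = n)
    (Q := fun t => Fsupp (N := n + n) n t ∧ t.card = n + n)
    (R := fun r => Gm (n + n) n ⊆ r ∧ r.card = n + (Gm (n + n) n).card) ?_ hθ (f_mem_Sp_card K n q)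
  intro s t hst hs ht
  have hμs : μ n s = n := by
    unfold μ; rw [Finset.inter_eq_left.mpr hs.1, hs.2]
  have hμt : μ n t = n := by have := ht.1.2; omega
  refine ⟨Gm_subset_of_μ (p := n) ?_, ?_⟩
  · rw [μ_union hst, hμs, hμt, card_Gm_nn]
  · rw [Finset.card_union_of_disjoint hst, hs.2, ht.2, card_Gm_nn]

/-- `E₋ ∧ f ⊆ Sp{Dm ⊆ r, |r| = n + |Dm|}`. -/
lemma EM_mul_f_mem (q : ℕ → K) {θ : HT K (In (n + n))} (hθ : θ ∈ Hom K (In (n + n)) (Dm (n + n) n) n) :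
    θ * w K (n + n) (n + n) q ∈
      Sp K (fun r : Finset (In (n + n)) => Dm (n + n) n ⊆ r ∧ r.card = n + (Dm (n + n) n).card) := by
  rw [Hom_eq_Sp] at hθ
  refine mul_mem_Sp (P := fun s => s ⊆ Dm (n + n) n ∧ s.card = n)
    (Q := fun t => Fsupp (N := n + n) n t ∧ t.card = n + n)
    (R := fun r => Dm (n + n) n ⊆ r ∧ r.card = n + (Dm (n + n) n).card) ?_ hθ (f_mem_Sp_card K n q)
  intro s t hst hs ht
  have hμs : μ n s = 0 := by
    unfold μ
    rw [Finset.card_eq_zero, ← Finset.disjoint_iff_inter_eq_empty]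
    exact Finset.disjoint_of_subset_left hs.1 (disjoint_Dm_Gm n)
  have hμt : μ n t = n := by have := ht.1.2; omega
  have hcard : (s ∪ t).card = n + (n + n) := by
    rw [Finset.card_union_of_disjoint hst, hs.2, ht.2]
  refine ⟨?_, by rw [hcard, card_Dm_nn]⟩
  -- |(s ∪ t) ∩ Dm| = |s ∪ t| − |(s ∪ t) ∩ Gm| = 2n = |Dm|
  have hμ : μ n (s ∪ t) = n := by rw [μ_union hst, hμs, hμt, zero_add]
  have hsplit : ((s ∪ t) ∩ Dm (n + n) n).card + ((s ∪ t) ∩ Gm (n + n) n).card = (s ∪ t).card := by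
    rw [Gm, ← Finset.sdiff_eq_inter_compl, Finset.card_inter_add_card_sdiff]
  unfold μ at hμ
  have hle : (Dm (n + n) n).card ≤ ((s ∪ t) ∩ Dm (n + n) n).card := by rw [card_Dm_nn]; omega
  have : (s ∪ t) ∩ Dm (n + n) n = Dm (n + n) n :=
    Finset.eq_of_subset_of_card_le Finset.inter_subset_right hle
  exact Finset.inter_eq_right.mp this

/-- `ψ₊(E₊) ⊆ E₋`, `ψ₋(E₋) ⊆ E₊`. -/
lemma psiP_mem (q : ℕ → K) {θ : HT K (In (n + n))} (hθ : θ ∈ Hom K (In (n + n)) (Gm (n + n) n) n) :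
    psiP K n q θ ∈ Hom K (In (n + n)) (Dm (n + n) n) n := by
  have h := strip_mem_Hom K (EP_mul_f_mem K q hθ)
  rw [compl_Gm] at h
  exact h

/-- `ψ₋` maps the left end `E₋ = Hom(Dm) n` into the right end `E₊ = Hom(Gm) n`. -/
lemma psiM_mem (q : ℕ → K) {θ : HT K (In (n + n))} (hθ : θ ∈ Hom K (In (n + n)) (Dm (n + n) n) n) :
    psiM K n q θ ∈ Hom K (In (n + n)) (Gm (n + n) n) n := by
  have h := strip_mem_Hom K (EM_mul_f_mem K q hθ)
  exact h

/-- `θ₊ ∧ f = ψ₊(θ₊) ∧ w₊`, `θ₋ ∧ f = ψ₋(θ₋) ∧ w₋`. -/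
lemma psiP_mul_wp (q : ℕ → K) {θ : HT K (In (n + n))} (hθ : θ ∈ Hom K (In (n + n)) (Gm (n + n) n) n) :
    psiP K n q θ * B K (In (n + n)) (Gm (n + n) n) = θ * w K (n + n) (n + n) q := by
  rw [psiP, LinearMap.comp_apply, LinearMap.mulRight_apply]
  exact strip_mul_B K (Sp_mono (fun r hr => hr.1) (EP_mul_f_mem K q hθ))

/-- `ψ₋(θ₋) ∧ w₋ = θ₋ ∧ f` for `θ₋ ∈ E₋`. -/
lemma psiM_mul_wm (q : ℕ → K) {θ : HT K (In (n + n))} (hθ : θ ∈ Hom K (In (n + n)) (Dm (n + n) n) n) :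
    psiM K n q θ * B K (In (n + n)) (Dm (n + n) n) = θ * w K (n + n) (n + n) q := by
  rw [psiM, LinearMap.comp_apply, LinearMap.mulRight_apply]
  exact strip_mul_B K (Sp_mono (fun r hr => hr.1) (EM_mul_f_mem K q hθ))

/-- the ranks of `ψ₊`, `ψ₋` on the ends are `ρ = rank H_n(q)` (ENDS–HANKEL + injectivity of the strip). -/
theorem finrank_map_psiP (q : ℕ → K) :
    Module.finrank K ↥((Hom K (In (n + n)) (Gm (n + n) n) n).map (psiP K n q)) =
      (hankel1 K (n + n) n q).rank := by
  rw [psiP, Submodule.map_comp, finrank_map_of_injOn K (strip K (Gm (n + n) n)) _ ?_]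
  · exact (finrank_map_f_Ends_nn K n q).2
  · intro x hx hx0
    obtain ⟨θ, hθ, rfl⟩ := Submodule.mem_map.mp hx
    exact strip_eq_zero K (Sp_mono (fun r hr => hr.1) (EP_mul_f_mem K q hθ)) hx0

/-- `ψ₋` has rank `ρ = rank H_n(q)` on `E₋`. -/
theorem finrank_map_psiM (q : ℕ → K) :
    Module.finrank K ↥((Hom K (In (n + n)) (Dm (n + n) n) n).map (psiM K n q)) =
      (hankel1 K (n + n) n q).rank := by
  rw [psiM, Submodule.map_comp, finrank_map_of_injOn K (strip K (Dm (n + n) n)) _ ?_]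
  · exact (finrank_map_f_Ends_nn K n q).1
  · intro x hx hx0
    obtain ⟨θ, hθ, rfl⟩ := Submodule.mem_map.mp hx
    exact strip_eq_zero K (Sp_mono (fun r hr => hr.1) (EM_mul_f_mem K q hθ)) hx0

/-- an end kills its own block monomial (`n ≥ 1`). -/
lemma EM_mul_wm (hn : 1 ≤ n) {θ : HT K (In (n + n))} (hθ : θ ∈ Hom K (In (n + n)) (Dm (n + n) n) n) :
    θ * B K (In (n + n)) (Dm (n + n) n) = 0 := by
  rw [Hom_eq_Sp] at hθ
  refine mul_B_eq_zero_of_mem_Sp (fun s hs hd => ?_) hθ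
  obtain ⟨i, hi⟩ : s.Nonempty := by rw [← Finset.card_pos, hs.2]; exact hn
  exact Finset.disjoint_left.mp hd hi (hs.1 hi)

/-- `θ₊ ∧ w₊ = 0` for `θ₊ ∈ E₊` (`n ≥ 1`). -/
lemma EP_mul_wp (hn : 1 ≤ n) {θ : HT K (In (n + n))} (hθ : θ ∈ Hom K (In (n + n)) (Gm (n + n) n) n) :
    θ * B K (In (n + n)) (Gm (n + n) n) = 0 := by
  rw [Hom_eq_Sp] at hθ
  refine mul_B_eq_zero_of_mem_Sp (fun s hs hd => ?_) hθ
  obtain ⟨i, hi⟩ : s.Nonempty := by rw [← Finset.card_pos, hs.2]; exact hn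
  exact Finset.disjoint_left.mp hd hi (hs.1 hi)

/-- **the ends expansion:** `(θ₋ + θ₊) ∧ v = (ψ₋θ₋ + b·θ₊) ∧ w₋ + (a·θ₋ + ψ₊θ₊) ∧ w₊`. -/
lemma ends_mul_vW (hn : 1 ≤ n) (q : ℕ → K) (a b : K) {θm θp : HT K (In (n + n))}
    (hm : θm ∈ Hom K (In (n + n)) (Dm (n + n) n) n) (hp : θp ∈ Hom K (In (n + n)) (Gm (n + n) n) n) :
    (θm + θp) * vW K (n + n) n q a b =
      (psiM K n q θm + b • θp) * B K (In (n + n)) (Dm (n + n) n) +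
        (a • θm + psiP K n q θp) * B K (In (n + n)) (Gm (n + n) n) := by
  rw [vW_mul_expand, add_mul, add_mul, add_mul, EM_mul_wm K hn hm, EP_mul_wp K hn hp, add_zero, zero_add,
    ← psiM_mul_wm K q hm, ← psiP_mul_wp K q hp, add_mul, add_mul, smul_mul_assoc, smul_mul_assoc]
  abel

/-- the two summands of the ends expansion are independent: both vanish if their sum does (`n ≥ 1`). -/
lemma ends_separation (hn : 1 ≤ n) {X Y : HT K (In (n + n))}
    (hX : X ∈ Hom K (In (n + n)) (Gm (n + n) n) n) (hY : Y ∈ Hom K (In (n + n)) (Dm (n + n) n) n)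
    (h0 : X * B K (In (n + n)) (Dm (n + n) n) + Y * B K (In (n + n)) (Gm (n + n) n) = 0) :
    X = 0 ∧ Y = 0 := by
  classical
  rw [Hom_eq_Sp] at hX hY
  have e1 : X * B K (In (n + n)) (Dm (n + n) n) ∈ Sp K (fun r : Finset (In (n + n)) => μ n r = n) := by
    refine mul_mem_Sp (P := fun s => s ⊆ Gm (n + n) n ∧ s.card = n) (Q := fun t => t = Dm (n + n) n)
      (R := fun r => μ n r = n) ?_ hX (B_mem_Sp rfl)
    intro s t hst hs ht
    subst ht
    rw [μ_union hst, μ_Dm, add_zero]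
    unfold μ; rw [Finset.inter_eq_left.mpr hs.1, hs.2]
  have e2 : Y * B K (In (n + n)) (Gm (n + n) n) ∈ Sp K (fun r : Finset (In (n + n)) => μ n r = n + n) := by
    refine mul_mem_Sp (P := fun s => s ⊆ Dm (n + n) n ∧ s.card = n) (Q := fun t => t = Gm (n + n) n)
      (R := fun r => μ n r = n + n) ?_ hY (B_mem_Sp rfl)
    intro s t hst hs ht
    subst ht
    rw [μ_union hst, μ_Gm, card_Gm_nn]
    have : μ n s = 0 := by
      unfold μ
      rw [Finset.card_eq_zero, ← Finset.disjoint_iff_inter_eq_empty]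
      exact Finset.disjoint_of_subset_left hs.1 (disjoint_Dm_Gm n)
    omega
  have d12 : ∀ r : Finset (In (n + n)), μ n r = n → ¬ μ n r = n + n := fun r h1 h2 => by omega
  have hXw : X * B K (In (n + n)) (Dm (n + n) n) = 0 := by
    have := congrArg (proj (K := K) (fun r : Finset (In (n + n)) => μ n r = n)) h0
    rwa [map_add, map_zero, proj_eq_self (fun s h => h) e1, proj_eq_zero (fun s h2 h1 => d12 s h1 h2) e2,
      add_zero] at this
  have hYw : Y * B K (In (n + n)) (Gm (n + n) n) = 0 := by
    have := congrArg (proj (K := K) (fun r : Finset (In (n + n)) => μ n r = n + n)) h0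
    rwa [map_add, map_zero, proj_eq_zero d12 e1, proj_eq_self (fun s h => h) e2, zero_add] at this
  have hXa : X ∈ Alg K (In (n + n)) (Gm (n + n) n) := by
    rw [Alg_eq_Sp]; exact Sp_mono (fun s hs => hs.1) hX
  have hYa : Y ∈ Alg K (In (n + n)) (Dm (n + n) n) := by
    rw [Alg_eq_Sp]; exact Sp_mono (fun s hs => hs.1) hY
  exact ⟨eq_zero_of_mul_B_eq_zero K (disjoint_Dm_Gm n).symm hXa hXw,
    eq_zero_of_mul_B_eq_zero K (disjoint_Dm_Gm n) hYa hYw⟩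

/-- the ends decompose: `θ ∈ Em n n` is `θ₋ + θ₊` with `θ₋ ∈ E₋`, `θ₊ ∈ E₊` (the two coordinate projections). -/
lemma Em_decomp {θ : HT K (In (n + n))} (hθ : θ ∈ Em K (n + n) n n) :
    ∃ θm ∈ Hom K (In (n + n)) (Dm (n + n) n) n, ∃ θp ∈ Hom K (In (n + n)) (Gm (n + n) n) n, θ = θm + θp := by
  classical
  refine ⟨proj (K := K) (fun s : Finset (In (n + n)) => s ⊆ Dm (n + n) n) θ, ?_,
    proj (K := K) (fun s : Finset (In (n + n)) => ¬ s ⊆ Dm (n + n) n) θ, ?_, (proj_add_proj_not _ θ).symm⟩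
  · rw [Hom_eq_Sp]
    exact Sp_mono (fun s hs => ⟨hs.2, hs.1.1⟩) (proj_mem_and (P := fun s => s ⊆ Dm (n + n) n) hθ)
  · rw [Hom_eq_Sp]
    refine Sp_mono (fun s hs => ⟨?_, hs.1.1⟩) (proj_mem_and (P := fun s => ¬ s ⊆ Dm (n + n) n) hθ)
    exact hs.1.2.resolve_left hs.2

/-- `E₋ ⊓ E₊ = ⊥` (`n ≥ 1`). -/
lemma EM_inf_EP (hn : 1 ≤ n) :
    Hom K (In (n + n)) (Dm (n + n) n) n ⊓ Hom K (In (n + n)) (Gm (n + n) n) n = ⊥ := by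
  rw [Hom_eq_Sp, Hom_eq_Sp]
  refine Sp_inf_Sp_eq_bot fun s hs hs' => ?_
  obtain ⟨i, hi⟩ : s.Nonempty := by rw [← Finset.card_pos, hs.2]; exact hn
  exact Finset.disjoint_left.mp (disjoint_Dm_Gm n) (hs.1 hi) (hs'.1 hi)

variable (n) in
/-- the Schur parametrisation `J θ₊ = θ₊ − a⁻¹·ψ₊θ₊` of the ends kernel. -/
noncomputable def Jmap (q : ℕ → K) (a : K) : HT K (In (n + n)) →ₗ[K] HT K (In (n + n)) :=
  LinearMap.id - a⁻¹ • psiP K n q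

variable (n) in
/-- the Schur operator `ψ₋ψ₊ − ab` (on all of `Λ N`; used on `E₊`). -/
noncomputable def schurOp (q : ℕ → K) (a b : K) : HT K (In (n + n)) →ₗ[K] HT K (In (n + n)) :=
  psiM K n q ∘ₗ psiP K n q - (a * b) • LinearMap.id

/-- unfolding of `J = id − a⁻¹ψ₊`. -/
lemma Jmap_apply (q : ℕ → K) (a : K) (θ : HT K (In (n + n))) :
    Jmap K n q a θ = θ - a⁻¹ • psiP K n q θ := by
  simp [Jmap]

/-- unfolding of the Schur operator `ψ₋ψ₊ − ab·id`. -/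
lemma schurOp_apply (q : ℕ → K) (a b : K) (θ : HT K (In (n + n))) :
    schurOp K n q a b θ = psiM K n q (psiP K n q θ) - (a * b) • θ := by
  simp [schurOp]

/-- **the ends kernel in Schur form:** for `a ≠ 0`, `Ends ⊓ ker(∧v) = J(E₊ ⊓ ker(ψ₋ψ₊ − ab))`. -/
theorem ends_ker_eq (hn : 1 ≤ n) (q : ℕ → K) {a : K} (ha : a ≠ 0) (b : K) :
    Em K (n + n) n n ⊓ LinearMap.ker (LinearMap.mulRight K (vW K (n + n) n q a b)) =
      (Hom K (In (n + n)) (Gm (n + n) n) n ⊓ LinearMap.ker (schurOp K n q a b)).map (Jmap K n q a) := by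
  apply le_antisymm
  · intro θ hθ0
    obtain ⟨hθ, h0⟩ := Submodule.mem_inf.mp hθ0
    rw [LinearMap.mem_ker, LinearMap.mulRight_apply] at h0
    obtain ⟨θm, hm, θp, hp, rfl⟩ := Em_decomp K hθ
    rw [ends_mul_vW K hn q a b hm hp] at h0
    have hX : psiM K n q θm + b • θp ∈ Hom K (In (n + n)) (Gm (n + n) n) n :=
      Submodule.add_mem _ (psiM_mem K q hm) (Submodule.smul_mem _ _ hp)
    have hY : a • θm + psiP K n q θp ∈ Hom K (In (n + n)) (Dm (n + n) n) n :=
      Submodule.add_mem _ (Submodule.smul_mem _ _ hm) (psiP_mem K q hp)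
    obtain ⟨hX0, hY0⟩ := ends_separation K hn hX hY h0
    -- θm = −a⁻¹ ψ₊ θp
    have hθm : θm = -(a⁻¹ • psiP K n q θp) := by
      have h1 : a • θm = -(psiP K n q θp) := eq_neg_of_add_eq_zero_left hY0
      have h2 := congrArg (fun z => a⁻¹ • z) h1
      simp only [smul_smul, inv_mul_cancel₀ ha, one_smul, smul_neg] at h2
      exact h2
    refine Submodule.mem_map.mpr ⟨θp, Submodule.mem_inf.mpr ⟨hp, ?_⟩, ?_⟩
    · rw [LinearMap.mem_ker, schurOp_apply]
      rw [hθm, map_neg, map_smul] at hX0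
      -- hX0 : -(a⁻¹ • ψ₋ψ₊ θp) + b • θp = 0
      have h4 : a⁻¹ • psiM K n q (psiP K n q θp) = b • θp := neg_add_eq_zero.mp hX0
      have h5 : psiM K n q (psiP K n q θp) = (a * b) • θp := by
        calc psiM K n q (psiP K n q θp) = a • (a⁻¹ • psiM K n q (psiP K n q θp)) := by
              rw [smul_smul, mul_inv_cancel₀ ha, one_smul]
          _ = a • (b • θp) := by rw [h4]
          _ = (a * b) • θp := by rw [smul_smul]
      rw [h5, sub_self]
    · rw [Jmap_apply, hθm]
      abel
  · intro y hy
    obtain ⟨θp, hθp, rfl⟩ := Submodule.mem_map.mp hy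
    obtain ⟨hp, hk⟩ := Submodule.mem_inf.mp hθp
    rw [LinearMap.mem_ker, schurOp_apply, sub_eq_zero] at hk
    have hm : -(a⁻¹ • psiP K n q θp) ∈ Hom K (In (n + n)) (Dm (n + n) n) n :=
      Submodule.neg_mem _ (Submodule.smul_mem _ _ (psiP_mem K q hp))
    have hJ : Jmap K n q a θp = -(a⁻¹ • psiP K n q θp) + θp := by rw [Jmap_apply]; abel
    refine Submodule.mem_inf.mpr ⟨?_, ?_⟩
    · rw [hJ]
      exact Submodule.add_mem _ (Hom_Dm_le_Em K n n hm) (Hom_Gm_le_Em K n n hp)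
    · have e1 : psiM K n q (-(a⁻¹ • psiP K n q θp)) + b • θp = 0 := by
        rw [map_neg, map_smul, hk, smul_smul, ← mul_assoc, inv_mul_cancel₀ ha, one_mul, neg_add_cancel]
      have e2 : a • (-(a⁻¹ • psiP K n q θp)) + psiP K n q θp = 0 := by
        rw [smul_neg, smul_smul, mul_inv_cancel₀ ha, one_smul, neg_add_cancel]
      rw [LinearMap.mem_ker, LinearMap.mulRight_apply, hJ, ends_mul_vW K hn q a b hm hp, e1, e2, zero_mul,
        zero_mul, add_zero]

/-- `dim(Ends ⊓ ker ∧v) = dim(E₊ ⊓ ker(ψ₋ψ₊ − ab))` for `a ≠ 0`. -/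
theorem finrank_ends_ker (hn : 1 ≤ n) (q : ℕ → K) {a : K} (ha : a ≠ 0) (b : K) :
    Module.finrank K ↥(Em K (n + n) n n ⊓ LinearMap.ker (LinearMap.mulRight K (vW K (n + n) n q a b))) =
      Module.finrank K ↥(Hom K (In (n + n)) (Gm (n + n) n) n ⊓ LinearMap.ker (schurOp K n q a b)) := by
  rw [ends_ker_eq K hn q ha b]
  refine finrank_map_of_injOn K (Jmap K n q a) _ fun x hx h0 => ?_
  have hxE : x ∈ Hom K (In (n + n)) (Gm (n + n) n) n := hx.1
  rw [Jmap_apply, sub_eq_zero] at h0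
  have h1 : x ∈ Hom K (In (n + n)) (Dm (n + n) n) n := by
    rw [h0]; exact Submodule.smul_mem _ _ (psiP_mem K q hxE)
  have : x ∈ Hom K (In (n + n)) (Dm (n + n) n) n ⊓ Hom K (In (n + n)) (Gm (n + n) n) n := ⟨h1, hxE⟩
  rw [EM_inf_EP K hn] at this
  exact (Submodule.mem_bot K).mp this

/-- `dim Ends = C(2n,n) + C(2n,n)` (`n ≥ 1`). -/
lemma finrank_Em_nn (hn : 1 ≤ n) :
    Module.finrank K ↥(Em K (n + n) n n) = (n + n).choose n + (n + n).choose n := by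
  classical
  rw [Em, finrank_Sp]
  have h : Finset.univ.filter (Endm (n + n) n n) =
      (Dm (n + n) n).powersetCard n ∪ (Gm (n + n) n).powersetCard n := by
    ext s
    simp only [Finset.mem_filter, Finset.mem_univ, true_and, Endm, Finset.mem_union, Finset.mem_powersetCard]
    tauto
  have hd : Disjoint ((Dm (n + n) n).powersetCard n) ((Gm (n + n) n).powersetCard n) := by
    rw [Finset.disjoint_left]
    intro s hs hs'
    rw [Finset.mem_powersetCard] at hs hs'
    obtain ⟨i, hi⟩ : s.Nonempty := by rw [← Finset.card_pos, hs.2]; exact hn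
    exact Finset.disjoint_left.mp (disjoint_Dm_Gm n) (hs.1 hi) (hs'.1 hi)
  rw [h, Finset.card_union_of_disjoint hd, Finset.card_powersetCard, Finset.card_powersetCard, card_Dm_nn,
    card_Gm_nn]

/-- **W-PURITY IN SCHUR FORM (Weil type (n,n), m = n ≥ 1, a ≠ 0; every q, b, every field).**
`rank(∧v ∣ HTⁿ) = C(2n,n)·(2 + ρ) − 2ρ − dim ker(ψ₋ψ₊ − ab ∣ E₊)`, `ρ = rank H_n(q)`, stated additively:
`finrank range(wedge (n+n) n v) + 2ρ + dim(E₊ ⊓ ker(ψ₋ψ₊ − ab)) = C(2n,n)·ρ + C(2n,n) + C(2n,n)`. The operators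
`ψ₊ = σ_{Gm}∘(∧f)`, `ψ₋ = σ_{Dm}∘(∧f)` have rank ρ on the ends (`finrank_map_psiP/psiM`). This is PART B §L.5's
W-PURITY(ρ) with the conjectured `S(q) = (−1)ⁿ(H_n(q)Ω_n)²` replaced by the explicit `ψ₋ψ₊`; their identification
(Flanders + Schur's lemma on SymⁿP) is the only remaining non-kernel step. -/
theorem weilPurity_schur (hn : 1 ≤ n) (q : ℕ → K) {a : K} (ha : a ≠ 0) (b : K) :
    Module.finrank K (LinearMap.range (wedge K (n + n) n (vW K (n + n) n q a b))) +
        2 * (hankel1 K (n + n) n q).rank +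
        Module.finrank K ↥(Hom K (In (n + n)) (Gm (n + n) n) n ⊓ LinearMap.ker (schurOp K n q a b)) =
      (n + n).choose n * (hankel1 K (n + n) n q).rank + ((n + n).choose n + (n + n).choose n) := by
  have h1 := weilPurity_structure K hn q a b
  have h2 := finrank_eq_map_add_inf_ker K (Em K (n + n) n n) (LinearMap.mulRight K (vW K (n + n) n q a b))
  rw [finrank_Em_nn K hn, finrank_ends_ker K hn q ha b] at h2
  omega

end SchurNN

end Summit.Ventures.HSemireg.Wedge.Weil
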